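import Mathlib.Analysis.Matrix.Order
import Literature.Analysis.Fourier.HyperbolicSystemsLp
import Literature.Analysis.Fourier.LpMultiplierConstant
import Literature.Barriers.AtomisticToContinuum.NoBVEstimatesMultiDLinearStep
import HarnessLib

/-!
# Rauch's linear step for symmetrizable systems without zeroth-order term: reduction to
Brenner–Thomée–Wahlbin's Lemma 1.1

`NoBVEstimatesMultiDLinearStep.lean` vendors the second ingredient of Rauch's linear step as
the named fact `Rauch1986_LpMultiplier_forces_commutation` ("(3) is a necessary … condition
for `M` to be an `Lᵖ` multiplier for some `1 < p < ∞`, `p ≠ 2`" [Rauch1986, p. 483]): for a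
constant-coefficient system in Rauch's class, `rauchSymbol A₀ A B₁ T ∈ M_p`, `p ≠ 2`, forces
`[A₀⁻¹Aⱼ, A₀⁻¹A_l] = 0`. This file PROVES, relative to the analytic Lemma 1.1 of
[BrennerThomeeWahlbin1975, Ch. 5 §1] alone (`BTW1975_hasLinearEigenvalues_of_isLpMultiplier`,
named fact in `Literature/Analysis/Fourier/HyperbolicSystemsLp.lean`), the case WITHOUT
ZEROTH-ORDER TERM (`B₁ = 0`) of the SYMMETRIZABLE branch of Rauch's class:

* symmetric systems (`A₀ = 1`, `Aⱼ` real symmetric — the setting of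
  [BrennerThomeeWahlbin1975, Ch. 5 §1]): Rauch's multiplier at time `T` is the solution
  symbol `exp(tP̂)` of `∂ₜu = Σ A'ⱼ∂ⱼu` at time `1` for the hermitean matrices `A'ⱼ = -TAⱼ`
  (`rauchSymbol_one_zero`, `hyperbolicSymbol_smul_one` — no dilation argument is needed to
  pass from the single time `T` to the time-one multiplier of Lemma 1.1:
  `exp(TP̂_A) = exp(P̂_{TA})`), so Lemma 1.1 makes the eigenvalues of `Σ ξⱼA'ⱼ` linear in `ξ`,
  Lemma 1.2 (proved in the tree: `commute_of_isHermitian_of_charpoly_sum_eq`) makes the `A'ⱼ`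
  commute, and `T ≠ 0` (`commute_of_isLpMultiplier_rauchSymbol_symmetric`);
* symmetrizable systems (`Sym A₀` symmetric positive definite, `Sym Aⱼ` symmetric): with
  `H = Sym A₀ = R²`, `R = H^{1/2}` (`CFC.sqrt`), one has `A₀⁻¹Aⱼ = H⁻¹ Sym Aⱼ = R⁻¹KⱼR` with
  `Kⱼ = R⁻¹(Sym Aⱼ)R⁻¹` SYMMETRIC, Rauch's symbol is conjugate to `rauchSymbol 1 K 0 T` by the
  constant matrix `R` (`rauchSymbol_zero_of_conj`, `Matrix.exp_conj'`), `M_p` is invariant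
  under constant conjugation (`Literature.Analysis.Fourier.IsLpMultiplier.conj`), and the
  symmetric case applies (`commute_of_isLpMultiplier_rauchSymbol_symmetrizable`,
  `lpMultiplier_forces_commutation_symmetrizable_of_BTW`).

What is NOT here: the strictly hyperbolic branch of Rauch's class, and any zeroth-order term
`B₁ ≠ 0` (see the docstring of `Rauch1986_LpMultiplier_forces_commutation` for the status of
the single-time statement with `B₁`).

## References

* [Rauch1986] J. Rauch, Comm. Math. Phys. 106 (1986) 481–484, Proof of Theorem p. 483.
* [BrennerThomeeWahlbin1975] P. Brenner, V. Thomée, L. B. Wahlbin, LNM 434 (1975), Ch. 5 §1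
  Thm 1.1, Lemmas 1.1–1.2; Ch. 1 Thm 2.7 / Ch. 5 (1.3) (constant factors).
-/

noncomputable section

open scoped ENNReal NNReal MatrixOrder Matrix

namespace Literature.Barriers.AtomisticToContinuum

open Literature.Analysis.Fourier Literature.LinearAlgebra.Matrix QuasilinearSystem

variable {d k : ℕ}

/-! ### Rauch's symbol versus the solution symbol of `∂ₜu = Σ Aⱼ∂ⱼu` -/

/-- For `A₀ = 1`, `B₁ = 0` the generator is `2πi Σ_l ξ_l A_l` (complexified).
[cite: Rauch1986, Proof of Theorem p. 483] -/
theorem rauchGenerator_one_zero (A : Fin d → Matrix (Fin k) (Fin k) ℝ) (ξ : Space d) :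
    rauchGenerator 1 A 0 ξ = ∑ l, (2 * Real.pi * ξ l * Complex.I) • (A l).map (algebraMap ℝ ℂ) := by
  have h1 : ((1 : Matrix (Fin k) (Fin k) ℝ)⁻¹).map (algebraMap ℝ ℂ) = 1 := by
    rw [inv_one, Matrix.map_one _ (map_zero _) (map_one _)]
  have h0 : (LinearMap.toMatrix' ((0 : (Fin k → ℝ) →L[ℝ] (Fin k → ℝ)) :
      (Fin k → ℝ) →ₗ[ℝ] (Fin k → ℝ))).map (algebraMap ℝ ℂ) = 0 := by
    rw [ContinuousLinearMap.toLinearMap_zero, LinearEquiv.map_zero, Matrix.map_zero _ (map_zero _)]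
  rw [rauchGenerator, h1, h0, add_zero, one_mul]

/-- **`rauchSymbol 1 A 0 T = exp(tP̂_A)` at `t = -T`**: Rauch's multiplier for
`∂ₜv + Σ Aⱼ∂ⱼv = 0` at time `T` is the solution symbol of `∂ₜu = Σ Aⱼ∂ⱼu` at time `-T`.
[cite: Rauch1986, Proof of Theorem p. 483] -/
theorem rauchSymbol_one_zero (A : Fin d → Matrix (Fin k) (Fin k) ℝ) (T : ℝ) :
    rauchSymbol 1 A 0 T = hyperbolicSymbol (fun j => (A j).map (algebraMap ℝ ℂ)) (-T) := by
  funext ξ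
  rw [rauchSymbol, hyperbolicSymbol, rauchGenerator_one_zero, Finset.smul_sum, Finset.smul_sum]
  congr 1
  refine Finset.sum_congr rfl fun l _ => ?_
  rw [smul_smul, smul_smul]
  congr 1
  push_cast
  ring

/-- `exp(tP̂_A) = exp(P̂_{tA})`: the solution symbol at time `t` is the time-one symbol of the
rescaled matrices `tAⱼ` (no dilation needed). [cite: BrennerThomeeWahlbin1975, Ch. 5 §1] -/
theorem hyperbolicSymbol_smul_one {N : ℕ} (A : Fin d → Matrix (Fin N) (Fin N) ℂ) (t : ℝ) :
    hyperbolicSymbol (fun j => ((t : ℝ) : ℂ) • A j) 1 = hyperbolicSymbol A t := by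
  funext ξ
  rw [hyperbolicSymbol, hyperbolicSymbol, Finset.smul_sum, Finset.smul_sum]
  congr 1
  refine Finset.sum_congr rfl fun l _ => ?_
  rw [smul_smul, smul_smul, smul_smul]
  congr 1
  push_cast
  ring

/-! ### Hermitean complexification -/

/-- A real symmetric matrix is hermitean as a complex matrix. [folklore] -/
theorem isHermitian_map_of_isSymm {n : Type*} {A : Matrix n n ℝ} (h : A.IsSymm) :
    (A.map (algebraMap ℝ ℂ)).IsHermitian := by
  ext i j
  have hij : A j i = A i j := by
    have := congr_fun (congr_fun h i) j
    simpa [Matrix.transpose_apply] using this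
  simp [Matrix.conjTranspose_apply, Matrix.map_apply, hij]

/-- Real multiples of hermitean matrices are hermitean. [folklore] -/
theorem isHermitian_real_smul {n : Type*} {H : Matrix n n ℂ} (h : H.IsHermitian) (c : ℝ) :
    ((c : ℂ) • H).IsHermitian := by
  ext i j
  have hij : (starRingEnd ℂ) (H j i) = H i j := by
    have := congr_fun (congr_fun h i) j
    simpa [Matrix.conjTranspose_apply] using this
  simp [Matrix.conjTranspose_apply, hij]

/-- Complexification of real matrices is injective and multiplicative, so commutation can be
read off over `ℂ`. [folklore] -/
theorem commute_of_commute_map {n : Type*} [Fintype n] {A B : Matrix n n ℝ}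
    (h : Commute (A.map (algebraMap ℝ ℂ)) (B.map (algebraMap ℝ ℂ))) : Commute A B := by
  have hinj : Function.Injective fun M : Matrix n n ℝ => M.map (algebraMap ℝ ℂ) := by
    intro M N hMN
    ext i j
    have := congr_fun (congr_fun hMN i) j
    simpa using this
  have h' : (A * B).map (algebraMap ℝ ℂ) = (B * A).map (algebraMap ℝ ℂ) := by
    rw [Matrix.map_mul, Matrix.map_mul]
    exact h.eq
  exact hinj h'

/-! ### The symmetric case of `Rauch1986_LpMultiplier_forces_commutation` from Lemma 1.1 -/

/-- **Symmetric systems without zeroth-order term: `M_T ∈ M_p`, `p ≠ 2`, forces commutation —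
from Brenner–Thomée–Wahlbin's Lemma 1.1 alone.** If the `Aⱼ` are real symmetric, `T ≠ 0`,
`1 ≤ p`, `p ≠ 2`, and Rauch's multiplier `rauchSymbol 1 A 0 T = exp(-2πiT Σ ξⱼAⱼ)` is an `Lᵖ`
multiplier, then the `Aⱼ` commute: the multiplier is `exp(P̂)` for the hermitean matrices
`-TAⱼ` (`rauchSymbol_one_zero`, `hyperbolicSymbol_smul_one`); Lemma 1.1
(`BTW1975_hasLinearEigenvalues_of_isLpMultiplier`, named fact) gives linear eigenvalues,
Lemma 1.2 (proved, `commute_of_isHermitian_of_charpoly_sum_eq`) commutation of the `-TAⱼ`,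
hence of the `Aⱼ`. This is `Rauch1986_LpMultiplier_forces_commutation` for `A₀ = 1`,
`B₁ = 0`, `Aⱼ` symmetric, relative to Lemma 1.1.
[cite: Rauch1986, Proof of Theorem p. 483 (last sentence); BrennerThomeeWahlbin1975, Ch. 5 §1
Thm 1.1 and Lemmas 1.1–1.2] -/
theorem commute_of_isLpMultiplier_rauchSymbol_symmetric
    (h₁ : BTW1975_hasLinearEigenvalues_of_isLpMultiplier) (A : Fin d → Matrix (Fin k) (Fin k) ℝ)
    (hA : ∀ j, (A j).IsSymm) {T : ℝ} (hT : T ≠ 0) {p : ℝ≥0∞} (hp : 1 ≤ p) (hp₂ : p ≠ 2)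
    (hM : IsLpMultiplier p (rauchSymbol 1 A 0 T)) (j l : Fin d) : Commute (A j) (A l) := by
  set Ac : Fin d → Matrix (Fin k) (Fin k) ℂ := fun j => (A j).map (algebraMap ℝ ℂ) with hAc
  set A' : Fin d → Matrix (Fin k) (Fin k) ℂ := fun j => (((-T : ℝ)) : ℂ) • Ac j with hA'
  have hA'h : ∀ j, (A' j).IsHermitian := fun j =>
    isHermitian_real_smul (isHermitian_map_of_isSymm (hA j)) (-T)
  have hsym : hyperbolicSymbol A' 1 = rauchSymbol 1 A 0 T := by
    rw [rauchSymbol_one_zero, hA', hyperbolicSymbol_smul_one]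
  have hM' : IsLpMultiplier p (hyperbolicSymbol A' 1) := by rwa [hsym]
  have hc : Commute (A' j) (A' l) := (h₁ A' hA'h p hp hp₂ hM').commute hA'h j l
  -- remove the factor `-T`
  have hTc : (((-T : ℝ)) : ℂ) ≠ 0 := by exact_mod_cast neg_ne_zero.2 hT
  have hc' : Commute (Ac j) (Ac l) := by
    have h2 := hc.eq
    simp only [hA', Matrix.smul_mul, Matrix.mul_smul, smul_smul] at h2
    exact smul_right_injective _ (mul_ne_zero hTc hTc) h2
  exact commute_of_commute_map hc'

/-- The same, packaged in the shape of `Rauch1986_LpMultiplier_forces_commutation` restricted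
to `A₀ = 1`, `B₁ = 0`, symmetric `Aⱼ` (where `A₀⁻¹Aⱼ = Aⱼ`), for any `1 < p < ∞`, `p ≠ 2`.
[cite: Rauch1986, Proof of Theorem p. 483; BrennerThomeeWahlbin1975, Ch. 5 §1 Thm 1.1] -/
theorem lpMultiplier_forces_commutation_symmetric_of_BTW
    (h₁ : BTW1975_hasLinearEigenvalues_of_isLpMultiplier) ⦃d k : ℕ⦄
    (A : Fin d → Matrix (Fin k) (Fin k) ℝ) (hA : ∀ j, (A j).IsSymm) (T : ℝ) (p : ℝ≥0∞)
    (hT : 0 < T) (hp : 1 < p) (hp₂ : p ≠ 2)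
    (hM : IsLpMultiplier p (rauchSymbol 1 A 0 T)) (j l : Fin d) :
    Commute ((1 : Matrix (Fin k) (Fin k) ℝ)⁻¹ * A j) ((1 : Matrix (Fin k) (Fin k) ℝ)⁻¹ * A l) := by
  rw [inv_one, one_mul, one_mul]
  exact commute_of_isLpMultiplier_rauchSymbol_symmetric h₁ A hA hT.ne' hp.le hp₂ hM j l

/-! ### The symmetrizable case -/

/-- For `B₁ = 0` the generator is `A₀⁻¹ (2πi Σ ξ_l A_l)`.
[cite: Rauch1986, Proof of Theorem p. 483] -/
theorem rauchGenerator_zero (A₀ : Matrix (Fin k) (Fin k) ℝ) (A : Fin d → Matrix (Fin k) (Fin k) ℝ)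
    (ξ : Space d) :
    rauchGenerator A₀ A 0 ξ =
      ∑ l, (2 * Real.pi * ξ l * Complex.I) • (A₀⁻¹ * A l).map (algebraMap ℝ ℂ) := by
  have h0 : (LinearMap.toMatrix' ((0 : (Fin k → ℝ) →L[ℝ] (Fin k → ℝ)) :
      (Fin k → ℝ) →ₗ[ℝ] (Fin k → ℝ))).map (algebraMap ℝ ℂ) = 0 := by
    rw [ContinuousLinearMap.toLinearMap_zero, LinearEquiv.map_zero, Matrix.map_zero _ (map_zero _)]
  rw [rauchGenerator, h0, add_zero, Finset.mul_sum]
  refine Finset.sum_congr rfl fun l _ => ?_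
  rw [Matrix.mul_smul, Matrix.map_mul]

/-- Conjugating the coefficients conjugates Rauch's symbol (`B₁ = 0`): if
`A₀⁻¹A_l = P⁻¹ K_l P` for all `l` with `P` invertible, then
`rauchSymbol A₀ A 0 T ξ = P⁻¹ (rauchSymbol 1 K 0 T ξ) P` (complexified).
[cite: Rauch1986, Proof of Theorem p. 483] -/
theorem rauchSymbol_zero_of_conj (A₀ : Matrix (Fin k) (Fin k) ℝ)
    (A K : Fin d → Matrix (Fin k) (Fin k) ℝ)
    (P : Matrix (Fin k) (Fin k) ℝ) (hP : IsUnit P.det) (hconj : ∀ l, A₀⁻¹ * A l = P⁻¹ * K l * P)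
    (T : ℝ) (ξ : Space d) :
    rauchSymbol A₀ A 0 T ξ =
      (P⁻¹).map (algebraMap ℝ ℂ) * rauchSymbol 1 K 0 T ξ * P.map (algebraMap ℝ ℂ) := by
  set Pc : Matrix (Fin k) (Fin k) ℂ := P.map (algebraMap ℝ ℂ) with hPc
  set Pic : Matrix (Fin k) (Fin k) ℂ := (P⁻¹).map (algebraMap ℝ ℂ) with hPic
  have hPP : Pc * Pic = 1 := by
    rw [hPc, hPic, ← Matrix.map_mul, Matrix.mul_nonsing_inv _ hP,
      Matrix.map_one _ (map_zero _) (map_one _)]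
  have hPP' : Pic * Pc = 1 := by
    rw [hPc, hPic, ← Matrix.map_mul, Matrix.nonsing_inv_mul _ hP,
      Matrix.map_one _ (map_zero _) (map_one _)]
  have hPcu : IsUnit Pc := IsUnit.of_mul_eq_one _ hPP
  have hinv : Pc⁻¹ = Pic := Matrix.inv_eq_right_inv hPP
  have hgen : rauchGenerator A₀ A 0 ξ = Pc⁻¹ * rauchGenerator 1 K 0 ξ * Pc := by
    rw [rauchGenerator_zero, rauchGenerator_one_zero, Finset.mul_sum, Finset.sum_mul, hinv]
    refine Finset.sum_congr rfl fun l _ => ?_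
    rw [hconj l, Matrix.map_mul, Matrix.map_mul, Matrix.mul_smul, Matrix.smul_mul, hPic, hPc]
  rw [rauchSymbol, rauchSymbol, hgen, ← hinv]
  rw [show -(T : ℂ) • (Pc⁻¹ * rauchGenerator 1 K 0 ξ * Pc)
      = Pc⁻¹ * (-(T : ℂ) • rauchGenerator 1 K 0 ξ) * Pc by rw [Matrix.mul_smul, Matrix.smul_mul]]
  exact Matrix.exp_conj' Pc _ hPcu

/-- **Symmetrizable systems without zeroth-order term**, relative to Lemma 1.1: if `Sym A₀`
is symmetric positive definite, the `Sym Aⱼ` are symmetric, `T ≠ 0`, `1 ≤ p`, `p ≠ 2` and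
`rauchSymbol A₀ A 0 T ∈ M_p`, then the `A₀⁻¹Aⱼ` commute. With `H = Sym A₀ = R²`
(`R = H^{1/2}`), `A₀⁻¹Aⱼ = H⁻¹(Sym Aⱼ) = R⁻¹ K_j R` for the SYMMETRIC `K_j = R⁻¹(Sym Aⱼ)R⁻¹`;
the symbol is conjugate to `rauchSymbol 1 K 0 T` by the constant matrix `R`
(`rauchSymbol_zero_of_conj`), `M_p` is invariant under constant conjugation
(`IsLpMultiplier.conj`), and the symmetric case applies. This is the symmetrizable branch of
`Rauch1986_LpMultiplier_forces_commutation` for `B₁ = 0`, relative to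
[BrennerThomeeWahlbin1975, Ch. 5 Lemma 1.1].
[cite: Rauch1986, Proof of Theorem p. 483; BrennerThomeeWahlbin1975, Ch. 5 §1 Thm 1.1 and
Lemmas 1.1–1.2] -/
theorem commute_of_isLpMultiplier_rauchSymbol_symmetrizable
    (h₁ : BTW1975_hasLinearEigenvalues_of_isLpMultiplier) (A₀ : Matrix (Fin k) (Fin k) ℝ)
    (A : Fin d → Matrix (Fin k) (Fin k) ℝ) (Sym : Matrix (Fin k) (Fin k) ℝ)
    (hH : (Sym * A₀).PosDef) (hS : ∀ j, (Sym * A j).IsSymm) {T : ℝ} (hT : T ≠ 0) {p : ℝ≥0∞}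
    (hp : 1 ≤ p) (hp₂ : p ≠ 2) (hM : IsLpMultiplier p (rauchSymbol A₀ A 0 T)) (j l : Fin d) :
    Commute (A₀⁻¹ * A j) (A₀⁻¹ * A l) := by
  set H : Matrix (Fin k) (Fin k) ℝ := Sym * A₀ with hHdef
  set R : Matrix (Fin k) (Fin k) ℝ := CFC.sqrt H with hRdef
  have hHnn : 0 ≤ H := Matrix.nonneg_iff_posSemidef.2 hH.posSemidef
  have hR2 : R * R = H := CFC.sqrt_mul_sqrt_self H hHnn
  have hRsa : IsSelfAdjoint R := (CFC.sqrt_nonneg H).isSelfAdjoint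
  have hRt : Rᵀ = R := by
    have h := hRsa.star_eq
    rwa [Matrix.star_eq_conjTranspose, Matrix.conjTranspose_eq_transpose_of_trivial] at h
  -- determinants
  have hdetH : H.det ≠ 0 := hH.det_pos.ne'
  have hdetR : IsUnit R.det := by
    rw [isUnit_iff_ne_zero]
    intro h0
    apply hdetH
    rw [← hR2, Matrix.det_mul, h0, mul_zero]
  have hdetSym : IsUnit Sym.det := by
    rw [isUnit_iff_ne_zero]
    intro h0; apply hdetH; rw [hHdef, Matrix.det_mul, h0, zero_mul]
  -- `A₀⁻¹ A_j = H⁻¹ (Sym A_j) = R⁻¹ K_j R`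
  set K : Fin d → Matrix (Fin k) (Fin k) ℝ := fun j => R⁻¹ * (Sym * A j) * R⁻¹ with hKdef
  have hconj : ∀ j, A₀⁻¹ * A j = R⁻¹ * K j * R := by
    intro j
    have h1 : A₀⁻¹ = H⁻¹ * Sym := by
      rw [hHdef, Matrix.mul_inv_rev, Matrix.mul_assoc, Matrix.nonsing_inv_mul _ hdetSym,
        Matrix.mul_one]
    have h2 : H⁻¹ = R⁻¹ * R⁻¹ := by rw [← hR2, Matrix.mul_inv_rev]
    rw [h1, h2, hKdef]
    simp only [Matrix.mul_assoc]
    rw [Matrix.nonsing_inv_mul _ hdetR, Matrix.mul_one]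
  have hKsymm : ∀ j, (K j).IsSymm := by
    intro j
    have hRit : (R⁻¹)ᵀ = R⁻¹ := by rw [Matrix.transpose_nonsing_inv, hRt]
    show (R⁻¹ * (Sym * A j) * R⁻¹)ᵀ = R⁻¹ * (Sym * A j) * R⁻¹
    rw [Matrix.transpose_mul, Matrix.transpose_mul, hRit, (hS j).eq]
    simp only [Matrix.mul_assoc]
  -- transfer the multiplier property
  have hM' : IsLpMultiplier p (rauchSymbol 1 K 0 T) := by
    have hc := hM.conj (R.map (algebraMap ℝ ℂ)) ((R⁻¹).map (algebraMap ℝ ℂ))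
    have hRR : R.map (algebraMap ℝ ℂ) * (R⁻¹).map (algebraMap ℝ ℂ) = 1 := by
      rw [← Matrix.map_mul, Matrix.mul_nonsing_inv _ hdetR,
        Matrix.map_one _ (map_zero _) (map_one _)]
    have heq : (fun ξ => R.map (algebraMap ℝ ℂ) * rauchSymbol A₀ A 0 T ξ *
        (R⁻¹).map (algebraMap ℝ ℂ)) = rauchSymbol 1 K 0 T := by
      funext ξ
      rw [rauchSymbol_zero_of_conj A₀ A K R hdetR hconj T ξ]
      simp only [← Matrix.mul_assoc, hRR, Matrix.one_mul]
      rw [Matrix.mul_assoc, hRR, Matrix.mul_one]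
    rwa [heq] at hc
  have hcK := commute_of_isLpMultiplier_rauchSymbol_symmetric h₁ K hKsymm hT hp hp₂ hM' j l
  -- conclude
  rw [hconj j, hconj l]
  have hRR' : R * R⁻¹ = 1 := Matrix.mul_nonsing_inv _ hdetR
  show R⁻¹ * K j * R * (R⁻¹ * K l * R) = R⁻¹ * K l * R * (R⁻¹ * K j * R)
  calc R⁻¹ * K j * R * (R⁻¹ * K l * R) = R⁻¹ * (K j * (R * R⁻¹) * K l) * R := by
          simp only [Matrix.mul_assoc]
    _ = R⁻¹ * (K l * (R * R⁻¹) * K j) * R := by rw [hRR', Matrix.mul_one, Matrix.mul_one, hcK.eq]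
    _ = R⁻¹ * K l * R * (R⁻¹ * K j * R) := by simp only [Matrix.mul_assoc]


/-- The symmetrizable case packaged in the shape of `Rauch1986_LpMultiplier_forces_commutation`
(restricted to `B₁ = 0` and an explicit constant symmetrizer `Sym`: `Sym A₀` symmetric
positive definite, `Sym Aⱼ` symmetric), for any `1 < p < ∞`, `p ≠ 2`, relative to
[BrennerThomeeWahlbin1975, Ch. 5 Lemma 1.1].
[cite: Rauch1986, Proof of Theorem p. 483; BrennerThomeeWahlbin1975, Ch. 5 §1 Thm 1.1] -/
theorem lpMultiplier_forces_commutation_symmetrizable_of_BTW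
    (h₁ : BTW1975_hasLinearEigenvalues_of_isLpMultiplier) ⦃d k : ℕ⦄
    (A₀ : Matrix (Fin k) (Fin k) ℝ) (A : Fin d → Matrix (Fin k) (Fin k) ℝ)
    (Sym : Matrix (Fin k) (Fin k) ℝ) (hH : (Sym * A₀).PosDef) (hS : ∀ j, (Sym * A j).IsSymm)
    (T : ℝ) (p : ℝ≥0∞) (hT : 0 < T) (hp : 1 < p) (hp₂ : p ≠ 2)
    (hM : IsLpMultiplier p (rauchSymbol A₀ A 0 T)) (j l : Fin d) :
    Commute (A₀⁻¹ * A j) (A₀⁻¹ * A l) :=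
  commute_of_isLpMultiplier_rauchSymbol_symmetrizable h₁ A₀ A Sym hH hS hT.ne' hp.le hp₂ hM j l

end Literature.Barriers.AtomisticToContinuum

end
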